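import Summits.CriticalPhenomena.Ising3DConformalLimit.Theses.MonotoneBlocking
import Summits.CriticalPhenomena.Ising3DConformalLimit.Theorems.HyperoctahedralRPExistsScaleCovariantLimitBlockLimitsGiveCrux
import HarnessLib

/-!
# Monotone blocking gives uniform regularity (item stmt-CriticalPhenomena-17056, route `MonotoneBlocking`)

Support item `BlockingGivesRegularity` of route `MonotoneBlocking` (sub-problem
`CriticalPhenomena/Ising3DConformalLimit`): `MonotoneBlockingTwo → NonSeparableModulus → UniformRegularity`, where the
conclusion is the text of item stmt-CriticalPhenomena-4658 (`MonotoneRG.UniformRegularity`) verbatim.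

The proof is a bridge onto the landed line `monotone-blocking-port` of the crux `ExistsScaleCovariantLimit`
(`Theorems/HyperoctahedralRPExistsScaleCovariantLimitBlockLimitsGiveCrux.lean`): the route's all-scale, cross-multiplied
monotonicity `BM₂` of the block covariances `bc L k = Σ_{x,y ∈ cube L} ⟨σ₀ σ_{Lk + x − y}⟩_{β_c}` gives, after dividing by the
block variances `V(L) = bc L 0 > 0` (`blockCov_zero_pos`), monotonicity of the block correlation ratio
`L ↦ ρ(L;k) = C(L;k)/V(L) = critBlockMoment 2 L (k₀,k₁)` (`critBlockMoment_two`) on `L ≥ 1`, hence the port's stub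
statement `Sig.stub_monotoneBlockingTwo` (eventual monotonicity at injective offsets); the landed
`blockTwoLimits_of_monotoneBlockingTwo` (monotone + bounded ⇒ convergent) and `uniformRegularity_of_blockTwoLimits`
(two-point scaling ⇒ dyadic pair ratio ⇒ `TwoPointDoubling` ⇒ `UniformRegularity`, all landed) finish. The hypothesis
`NonSeparableModulus` is not used: as the tree stands, doubling alone gives `UniformRegularity`
(`ItemMaps.uniformRegularity_of_doubling`).

References: A. Messager, S. Miracle-Solé, J. Stat. Phys. 17 (1977); M. Aizenman, H. Duminil-Copin, Ann. Math. 194 (2021),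
arXiv:1912.07973 Remark 5.10. No definitions, no named-fact hypotheses, no `sorry`.
-/

noncomputable section

namespace Summit.CriticalPhenomena.Ising3DConformalLimit.MonotoneBlockingBlockingGivesRegularity

open Literature.Probability.LatticeModels Filter Set
open scoped Topology BigOperators
open Summit.CriticalPhenomena.Ising3DConformalLimit.Theses
open Summit.CriticalPhenomena.Ising3DConformalLimit.Cruxes.ExistsScaleCovariantLimit.MonotoneBlockingPort

/-- The route's block covariance `bc L k = Σ_{x,y ∈ cube L} ⟨σ₀σ_{Lk + x − y}⟩_{β_c}` is the port's
`blockCov L k = Σ_{x,y ∈ cube L} ⟨σ₀σ_{y − x + Lk}⟩_{β_c}` (exchange the two summation variables). [folklore] -/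
theorem bc_eq_blockCov (L : ℕ) (k : Site 3) :
    (∑ x ∈ cube L, ∑ y ∈ cube L, criticalTwoPoint 3 ((L : ℤ) • k + x - y)) = blockCov L k := by
  unfold blockCov
  rw [Finset.sum_comm]
  refine Finset.sum_congr rfl fun x _ => Finset.sum_congr rfl fun y _ => ?_
  congr 1
  abel

/-- One step of `BM₂`, read in the port's vocabulary: `C(L;k) · V(L+1) ≤ C(L+1;k) · V(L)` for `L ≥ 1`
(the route's `cube`/`bc` are definitionally the port's `cube`/the double sum of `bc_eq_blockCov`). [folklore] -/
theorem blockCov_cross_step (h : MonotoneBlocking.MonotoneBlockingTwo) (L : ℕ) (hL : 1 ≤ L) (k : Site 3) :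
    blockCov L k * blockCov (L + 1) 0 ≤ blockCov (L + 1) k * blockCov L 0 := by
  have h' :
      (∑ x ∈ cube L, ∑ y ∈ cube L, criticalTwoPoint 3 ((L : ℤ) • k + x - y)) *
          (∑ x ∈ cube (L + 1), ∑ y ∈ cube (L + 1), criticalTwoPoint 3 (((L + 1 : ℕ) : ℤ) • (0 : Site 3) + x - y)) ≤
        (∑ x ∈ cube (L + 1), ∑ y ∈ cube (L + 1), criticalTwoPoint 3 (((L + 1 : ℕ) : ℤ) • k + x - y)) *
          (∑ x ∈ cube L, ∑ y ∈ cube L, criticalTwoPoint 3 ((L : ℤ) • (0 : Site 3) + x - y)) :=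
    h L hL k
  rwa [bc_eq_blockCov, bc_eq_blockCov, bc_eq_blockCov, bc_eq_blockCov] at h'

/-- `BM₂` divided through by the block variances: the block correlation ratio `ρ(L;k) = C(L;k)/V(L)` is
non-decreasing from `L` to `L+1` for every `L ≥ 1` (`V(L) > 0` by `blockCov_zero_pos`). [folklore] -/
theorem blockCov_ratio_step (h : MonotoneBlocking.MonotoneBlockingTwo) (L : ℕ) (hL : 1 ≤ L) (k : Site 3) :
    blockCov L k / blockCov L 0 ≤ blockCov (L + 1) k / blockCov (L + 1) 0 := by
  rw [div_le_div_iff₀ (blockCov_zero_pos L hL) (blockCov_zero_pos (L + 1) (by omega))]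
  exact blockCov_cross_step h L hL k

/-- **`BM₂` (route `MonotoneBlocking`) ⟹ the port's stub `Sig.stub_monotoneBlockingTwo`:** for every offset pair
`(k₀,k₁)` the block two-point ratio `L ↦ R₂(L;(k₀,k₁)) = C(L;k₁−k₀)/V(L)` (`critBlockMoment_two`) is monotone on `L ≥ 1`
(injectivity of the offsets is not needed). [folklore] -/
theorem stub_monotoneBlockingTwo_of_monotoneBlockingTwo (h : MonotoneBlocking.MonotoneBlockingTwo) :
    Sig.stub_monotoneBlockingTwo := by
  intro k _
  refine ⟨1, Or.inl ?_⟩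
  have hstep : ∀ n ≥ 1, critBlockMoment 2 n k ≤ critBlockMoment 2 (n + 1) k := by
    intro n hn
    rw [critBlockMoment_two, critBlockMoment_two]
    exact blockCov_ratio_step h n hn (k 1 - k 0)
  exact monotoneOn_nat_Ici_of_le_succ hstep

/-- **`BM₂` ⟹ item 4658 `UniformRegularity`** (uniform bounds, asymptotic equicontinuity and two-point positivity of the
`ρ★`-rescaled critical correlators on compacts), through the landed port: `blockTwoLimits_of_monotoneBlockingTwo` and
`uniformRegularity_of_blockTwoLimits`. [cite: AizenmanDuminilCopinAnnals2021, arXiv:1912.07973 Remark 5.10] -/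
theorem uniformRegularity_of_monotoneBlockingTwo (h : MonotoneBlocking.MonotoneBlockingTwo) :
    MonotoneRG.UniformRegularity :=
  uniformRegularity_of_blockTwoLimits
    (blockTwoLimits_of_monotoneBlockingTwo (stub_monotoneBlockingTwo_of_monotoneBlockingTwo h))

/-- **Item stmt-CriticalPhenomena-17056 `BlockingGivesRegularity`:** `MonotoneBlockingTwo → NonSeparableModulus →
UniformRegularity` (the conclusion is the text of `MonotoneRG.UniformRegularity`, definitionally). The second hypothesis is
not used. [folklore] -/
theorem blockingGivesRegularity_proof : MonotoneBlocking.BlockingGivesRegularity := by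
  intro hBM2 _
  exact uniformRegularity_of_monotoneBlockingTwo hBM2

end Summit.CriticalPhenomena.Ising3DConformalLimit.MonotoneBlockingBlockingGivesRegularity

end
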